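import Summits.Parity.GeneralizedHardyLittlewood.Theorems.BeyondDiagonalBeatsQuarter.CornerAbel
import HarnessLib

/-!
# Route `PrimeLevelFamEdge`, crux K_A `MomentsBeyondDiagonal` (stmt-Parity-20007), line «petersson_layers» v4, stub `stub_diag`:
# **the δ-subtraction lemma for a both-sided decorated remainder monomial, ENVELOPE EXPONENT AS A PARAMETER** (brick of (R₃₃))

`…DiagRemTwoTwoDeltaSub.abs_doubleSum_delta_sub_le` (p829899) verbatim with the envelope `9C₀(1+|log 2αY²|)⁶` of the order-`(2,2)`
kernels replaced by `9C₀(1+|log 2αY²|)^N`: the sixteen kernels `r_ab`, `a, b ≤ 3`, of the order-`(3,3)` remainder estimate (R₃₃)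
carry the envelope exponent `8` (`…DiagRemThreeThreeBose`), and the both-sided monomials of (R₃₃) (`P₂ ⊗ P₂ · r_ab`, `a + b ≤ 2`,
and `P₂ ⊗ (3P₂²−2P₄) · r₀₀`) are δ-subtracted exactly as the one both-sided monomial of (R₂₂). Writing `b = c·δ₁ + b̃`
(`b̃` has small tails): `b⊗b = b̃⊗b + c·(δ₁⊗b̃) + c²·(δ₁⊗δ₁)`.

* `abs_doubleSum_delta_sub_le_pow` — **the bound for `Σ_{k₁,k₂≤Y} b(k₁)b(k₂)ℓ⁺ⁱℓ⁺ʲR(αk₁k₂)`, envelope exponent `N`.**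

Def-free; theorems only; elementary. Helper `--supports stmt-Parity-20007`; closes nothing; K_A, K_B and the Parity summit are NOT
proved; nothing about Landau–Siegel zeros.

## References
* E. Kowalski, P. Michel, J. VanderKam, J. reine angew. Math. 526 (2000), Prop. 5.1 p. 18.
  [cite: KowalskiMichelVanderKam2000, Prop. 5.1 — derivation (both-sided decorated remainder monomials)]
-/

noncomputable section

open Real Finset

namespace Summit.Parity.GeneralizedHardyLittlewood.Theorems.MomentsBeyondDiagonal.DiagCorner

open Summit.Parity.GeneralizedHardyLittlewood.Theorems.BeyondDiagonalBeatsQuarter.Corner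

/-- **δ-subtraction for a both-sided decorated remainder monomial.** Let `R` satisfy the two-sequence estimate with constant
`C₀` and envelope exponent `N` (`…DiagRemTwoTwoDeltaSub.abs_doubleSum_delta_sub_le` is `N = 6`). Let `b` have column bound `B_b` (`|Σ_{k≤e}b| ≤ B_b`, `e ≤ ⌊Y⌋`) and let `b̃ = b − c·δ₁` have tails
`|Σ_{k≤e} b̃| ≤ T` for `e ≥ K₁`. Then `|Σ_{k₁,k₂≤Y} b(k₁)b(k₂)ℓ⁺(k₁)ⁱℓ⁺(k₂)ʲR(αk₁k₂)|` is at most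
`[S_i(b̃)·B_b·logʲY·3C₀√(2αK₁Y) + S_j(b)·2T·logⁱY·9C₀x^N] + |c|·[S_j(b̃)·logⁱY·3C₀√(2αK₁Y) + S_i(δ₁)·2T·logʲY·9C₀x^N]
+ c²·ℓ⁺(1)ⁱℓ⁺(1)ʲ·|R(α)|` (`x = 1+|log 2αY²|`, `S_m(f) = Σ_{k≤Y}|f(k)|ℓ⁺(k)^m`).
[cite: KowalskiMichelVanderKam2000, Prop. 5.1 — derivation (both-sided decorated remainder monomials)] -/
theorem abs_doubleSum_delta_sub_le_pow (N : ℕ) {R : ℝ → ℝ} {C₀ : ℝ}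
    (hR2 : ∀ (a₁ a₂ : ℕ → ℝ) (Y α B η : ℝ) (K₁ i j : ℕ), 1 ≤ Y → 0 < α → 1 ≤ i → 1 ≤ j →
      (∀ e : ℕ, e ≤ ⌊Y⌋₊ → |∑ k ∈ Icc 1 e, a₂ k| ≤ B) → (∀ e : ℕ, K₁ ≤ e → |∑ k ∈ Icc 1 e, a₁ k| ≤ η) →
      2 * α * K₁ * Y ≤ 1 →
      |∑ k₁ ∈ Icc 1 ⌊Y⌋₊, ∑ k₂ ∈ Icc 1 ⌊Y⌋₊,
          a₁ k₁ * a₂ k₂ * ellp Y k₁ ^ i * ellp Y k₂ ^ j * R (α * k₁ * k₂)| ≤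
        (∑ k ∈ Icc 1 ⌊Y⌋₊, |a₁ k| * ellp Y k ^ i) * (B * (Real.log Y ^ j * (3 * C₀ * Real.sqrt (2 * α * K₁ * Y)))) +
          (∑ k ∈ Icc 1 ⌊Y⌋₊, |a₂ k| * ellp Y k ^ j) *
            ((2 * η) * (Real.log Y ^ i * (9 * C₀ * (1 + |Real.log (2 * α * Y ^ 2)|) ^ N))))
    (b : ℕ → ℝ) (c T Bb : ℝ) {Y α : ℝ} {K₁ i j : ℕ} (hY : 1 ≤ Y) (hα : 0 < α) (hi : 1 ≤ i) (hj : 1 ≤ j)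
    (hY₁ : 2 * α * K₁ * Y ≤ 1)
    (hbt : ∀ e : ℕ, K₁ ≤ e → |∑ k ∈ Icc 1 e, (b k - if k = 1 then c else 0)| ≤ T)
    (hbcol : ∀ e : ℕ, e ≤ ⌊Y⌋₊ → |∑ k ∈ Icc 1 e, b k| ≤ Bb) :
    |∑ k₁ ∈ Icc 1 ⌊Y⌋₊, ∑ k₂ ∈ Icc 1 ⌊Y⌋₊, b k₁ * b k₂ * ellp Y k₁ ^ i * ellp Y k₂ ^ j * R (α * k₁ * k₂)| ≤
      ((∑ k ∈ Icc 1 ⌊Y⌋₊, |b k - if k = 1 then c else 0| * ellp Y k ^ i) *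
          (Bb * (Real.log Y ^ j * (3 * C₀ * Real.sqrt (2 * α * K₁ * Y)))) +
        (∑ k ∈ Icc 1 ⌊Y⌋₊, |b k| * ellp Y k ^ j) *
          ((2 * T) * (Real.log Y ^ i * (9 * C₀ * (1 + |Real.log (2 * α * Y ^ 2)|) ^ N)))) +
      |c| * ((∑ k ∈ Icc 1 ⌊Y⌋₊, |b k - if k = 1 then c else 0| * ellp Y k ^ j) *
          (1 * (Real.log Y ^ i * (3 * C₀ * Real.sqrt (2 * α * K₁ * Y)))) +
        (∑ k ∈ Icc 1 ⌊Y⌋₊, |(if k = 1 then (1 : ℝ) else 0)| * ellp Y k ^ i) *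
          ((2 * T) * (Real.log Y ^ j * (9 * C₀ * (1 + |Real.log (2 * α * Y ^ 2)|) ^ N)))) +
      c ^ 2 * ellp Y 1 ^ i * ellp Y 1 ^ j * |R α| := by
  set I := Icc 1 ⌊Y⌋₊ with hI
  set bt : ℕ → ℝ := fun k ↦ b k - if k = 1 then c else 0 with hbtdef
  set δ : ℕ → ℝ := fun k ↦ if k = 1 then (1 : ℝ) else 0 with hδdef
  have hY0 : 0 < Y := by linarith
  have h1I : 1 ∈ I := by
    rw [hI, Finset.mem_Icc]; exact ⟨le_rfl, Nat.le_floor (by simpa using hY)⟩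
  -- `b = bt + c·δ`
  have hb : ∀ k, b k = bt k + c * δ k := by
    intro k; simp only [hbtdef, hδdef]; split_ifs <;> ring
  -- the three pieces
  set F : ℕ → ℕ → ℝ := fun k₁ k₂ ↦ ellp Y k₁ ^ i * ellp Y k₂ ^ j * R (α * k₁ * k₂) with hF
  have hsplit : ∑ k₁ ∈ I, ∑ k₂ ∈ I, b k₁ * b k₂ * ellp Y k₁ ^ i * ellp Y k₂ ^ j * R (α * k₁ * k₂) =
      (∑ k₁ ∈ I, ∑ k₂ ∈ I, bt k₁ * b k₂ * ellp Y k₁ ^ i * ellp Y k₂ ^ j * R (α * k₁ * k₂)) +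
      c * (∑ k₁ ∈ I, ∑ k₂ ∈ I, δ k₁ * bt k₂ * ellp Y k₁ ^ i * ellp Y k₂ ^ j * R (α * k₁ * k₂)) +
      c ^ 2 * (∑ k₁ ∈ I, ∑ k₂ ∈ I, δ k₁ * δ k₂ * ellp Y k₁ ^ i * ellp Y k₂ ^ j * R (α * k₁ * k₂)) := by
    rw [Finset.mul_sum, Finset.mul_sum, ← Finset.sum_add_distrib, ← Finset.sum_add_distrib]
    refine Finset.sum_congr rfl fun k₁ _ ↦ ?_
    rw [Finset.mul_sum, Finset.mul_sum, ← Finset.sum_add_distrib, ← Finset.sum_add_distrib]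
    refine Finset.sum_congr rfl fun k₂ _ ↦ ?_
    rw [hb k₁, hb k₂]; ring
  -- the `δ⊗δ` piece is a single value
  have hδδ : ∑ k₁ ∈ I, ∑ k₂ ∈ I, δ k₁ * δ k₂ * ellp Y k₁ ^ i * ellp Y k₂ ^ j * R (α * k₁ * k₂) =
      ellp Y 1 ^ i * ellp Y 1 ^ j * R α := by
    rw [Finset.sum_eq_single_of_mem 1 h1I (fun k₁ _ hk₁ ↦ by
      simp only [hδdef, if_neg hk₁, zero_mul, Finset.sum_const_zero])]
    rw [Finset.sum_eq_single_of_mem 1 h1I (fun k₂ _ hk₂ ↦ by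
      simp only [hδdef, if_neg hk₂, mul_zero, zero_mul])]
    simp only [hδdef, if_true, Nat.cast_one, mul_one, one_mul]
  -- the `δ⊗b̃` piece after the swap `k₁ ↔ k₂`
  have hswap : ∑ k₁ ∈ I, ∑ k₂ ∈ I, δ k₁ * bt k₂ * ellp Y k₁ ^ i * ellp Y k₂ ^ j * R (α * k₁ * k₂) =
      ∑ k₁ ∈ I, ∑ k₂ ∈ I, bt k₁ * δ k₂ * ellp Y k₁ ^ j * ellp Y k₂ ^ i * R (α * k₁ * k₂) := by
    rw [Finset.sum_comm]
    refine Finset.sum_congr rfl fun k₁ _ ↦ Finset.sum_congr rfl fun k₂ _ ↦ ?_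
    rw [show α * (k₂ : ℝ) * k₁ = α * k₁ * k₂ by ring]; ring
  -- partial sums of `δ` are `≤ 1`
  have hδcol : ∀ e : ℕ, e ≤ ⌊Y⌋₊ → |∑ k ∈ Icc 1 e, δ k| ≤ 1 := by
    intro e _
    rcases Nat.eq_zero_or_pos e with rfl | he
    · simp
    · rw [Finset.sum_eq_single_of_mem 1 (Finset.mem_Icc.2 ⟨le_rfl, he⟩) (fun k _ hk ↦ by
        simp only [hδdef, if_neg hk])]
      simp [hδdef]
  -- the two applications of the two-sequence estimate
  have hA := hR2 bt b Y α Bb T K₁ i j hY hα hi hj hbcol hbt hY₁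
  have hB := hR2 bt δ Y α 1 T K₁ j i hY hα hj hi hδcol hbt hY₁
  rw [← hI] at hA hB
  rw [hsplit, hswap, hδδ]
  calc _ ≤ |∑ k₁ ∈ I, ∑ k₂ ∈ I, bt k₁ * b k₂ * ellp Y k₁ ^ i * ellp Y k₂ ^ j * R (α * k₁ * k₂)| +
        |c * ∑ k₁ ∈ I, ∑ k₂ ∈ I, bt k₁ * δ k₂ * ellp Y k₁ ^ j * ellp Y k₂ ^ i * R (α * k₁ * k₂)| +
        |c ^ 2 * (ellp Y 1 ^ i * ellp Y 1 ^ j * R α)| := abs_add_three _ _ _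
    _ ≤ _ := by
        rw [abs_mul, abs_mul, abs_pow, sq_abs, abs_mul, abs_mul, abs_pow, abs_pow,
          abs_of_nonneg (ellp_nonneg Y 1)]
        have h3 : c ^ 2 * (ellp Y 1 ^ i * ellp Y 1 ^ j * |R α|) = c ^ 2 * ellp Y 1 ^ i * ellp Y 1 ^ j * |R α| := by
          ring
        rw [h3]
        exact add_le_add (add_le_add hA (mul_le_mul_of_nonneg_left hB (abs_nonneg c))) le_rfl

end Summit.Parity.GeneralizedHardyLittlewood.Theorems.MomentsBeyondDiagonal.DiagCorner

end
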